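import Summits.BirchSwinnertonDyer.BirchSwinnertonDyer.Theorems.AdditiveBranchIMCGordTwoRankOneUnitSliceCrux
import Summits.BirchSwinnertonDyer.BirchSwinnertonDyer.Theorems.AdditiveBranchIMCGordTwoRankOneUnitCoeff
import Summits.BirchSwinnertonDyer.Rank1Residual.X11b.ShaAnBinderFromIndexRecord
import HarnessLib

/-!
# Route `AdditiveBranchIMC` (rung K1), crux `GordTwoRankOne` (item 19358): the `#Ш_an`-unit window's datum
# DISCHARGED IN THE KERNEL from an exact Heegner-index record (Gross–Zagier bookkeeping, x11b / multr1-p2), on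
# EVERY cell row — reducible `E[p]` included — and the resulting `BSD(E,p)` doors
# (cell `bsd-addord`, seat `bsd-addord-k1-c3` gen 5, D-0074 row B2; sequel of `…GordTwoRankOneShaAnUnit`)

HONEST FRAMING. THEOREMS ONLY: no definition, no named fact, no `sorry`, nothing booked; BSD is not proved by
any of this; the crux stays OPEN at class level on its content window. Per pair; every non-published input is
an EXACT finite datum of the kind the programme's Heegner-index lane records.

WHY. The companion file reads the crux's lower half (`Typed.MissingLowerBoundAt W p`) for free from the datum
"`#Ш(E)_an = s ∈ ℚ`, `ord_p s ≤ 0`". In analytic rank ONE that datum's admissibility as a certificate input is the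
programme's standing "D-a" question (the number is a regulator quotient; tables round it). The x11b unit answered
it IN THE KERNEL for `E[p]` irreducible: by the Gross–Zagier bookkeeping identity
(`X11b.exists_shaAn_padicVal_eq_of_heegner`, Jetchev–Skinner–Wan 2017 (eq:gz for K′) + (eq:tamK), exact at odd `p`)
`ord_p #Ш(E)_an + ord_p q_d + ord_p ∏c_ℓ(E) + 2·ord_p #E^{d_K}(ℚ)_tors = 2·ord_p [E(K) : ℤP]`
for a Heegner point `P` of a parametrisation datum with `p ∤ c`, a Heegner field `K` with `p ∤ #𝓞_K^×`, a minimal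
twist model with `ord_p u = 0` and the twist's RANK-ZERO algebraic central value `q_d = L(E^{d_K},1)/Ω ∈ ℚ^×` —
all EXACT data — so `ord_p #Ш(E)_an ≤ 0` IS the record inequality
`2·ord_p [E(K):ℤP] ≤ ord_p q_d + ord_p ∏c_ℓ(E) + 2·ord_p #E^{d_K}(ℚ)_tors`. This file:

* §1 (class-free, any odd `p`, any reduction type, `E[p]` reducible allowed)
  `exists_shaAn_padicValRat_le_zero_of_indexRecord_tors` — the record inequality WITH the twist-torsion term ⇒
  `∃ s, shaAn W = s ∧ ord_p s ≤ 0`; `missingLowerBoundAt_of_indexRecord_tors` — hence the lower half; and the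
  `E[p]`-irreducible forms `missingLowerBoundAt_of_indexRecord` (x11b's `exists_shaAn_padicValRat_le_zero_of_indexRecord`,
  torsion term absent).
* §2 the cell: `cellGordTwo_missingLowerBoundAt_of_indexRecord_tors` — the CRUX'S STATEMENT AT THE PAIR on every
  (G-ord, `e = 2`) row of analytic rank `1` (any image, CM or not, any parity, anomalous or not) from PUBLISHED
  facts (`hGZ` Gross–Zagier V.(2.1), `hKo` Kolyvagin, `hGZK`, `hmod`) + the exact record — NO Λ-adic input, NO
  `p`-adic Gross–Zagier, NO Schneider, NO reading, NO `A′`.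
The `BSD(E,p)` doors are then the companion file's `classX{3,4}Gord_bsdp_rankOne{,_odd,_three}_…_of_shaAnUnit`
fed with the `⟨s, hs, hsv⟩` produced here (one `obtain`); they are not restated.

NOT here: any evaluation of an index, of `q_d`, of a Manin constant (`p ∤ c(Dt)` is a binder — Mazur 1978: it
holds for the optimal curve when `p² ∤ 4N`, which FAILS at an additive `p`; so on the cell the Manin datum is a
genuine per-pair input, the programme's `MANIN-DB` rider), or of `#Ш_an`; any class statement; any booking.

References: [JetchevSkinnerWan2017] §7.3.1, §7.4.1; [GrossZagier1986] V.§2; [KolyvaginEulerSystems1990] Thm. A;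
[Mazur1978] Cor. 4.1; [Miller2011LMS] §1, Def. 1.1; cell TARGET.md §2; HOME/k1-c3/CERT-ROADS-19358-g5.md.
-/

set_option autoImplicit false
set_option linter.dupNamespace false
noncomputable section
open scoped Classical MatrixGroups ModularForm NumberField
open CongruenceSubgroup WeierstrassCurve NumberField IsDedekindDomain Field
  Literature.NumberTheory.EllipticCurves Literature.NumberTheory.EllipticCurves.ModularForms
  Literature.NumberTheory.EllipticCurves.Rank1Residual
  Literature.NumberTheory.EllipticCurves.Rank1Residual.Typed
  Literature.NumberTheory.QuadraticFields
  Summit.BirchSwinnertonDyer.Rank1Residual.AdditivePotMult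
  Summit.BirchSwinnertonDyer.Rank1Residual.Additive
  Summit.BirchSwinnertonDyer.Rank1Residual

namespace Summit.BirchSwinnertonDyer.BirchSwinnertonDyer.Theorems.AdditiveBranchIMCGordTwoRankOne

/-! ### §1 Class-free: the datum `ord_p #Ш_an ≤ 0` from the exact index record, reducible `E[p]` allowed -/

section Record

variable (W : WeierstrassCurve ℚ) [W.IsElliptic] [W.IsGloballyMinimal] (p : ℕ) [Fact p.Prime]
  (N : ℕ) [NeZero N] (K : Type) [Field K] [NumberField K]
  (Dt : ModularParametrizationData W N) (H : HeegnerDatum N (NumberField.discr K)) (ι : K →+* ℂ)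
  (P : (W.baseChange K).toAffine.Point)

/-- **The record inequality WITH the twist-torsion term gives `ord_p #Ш(E)_an ≤ 0`** (class-free, any odd `p`,
any reduction type at `p`, `E[p]` reducible allowed). Data as in `X11b.exists_shaAn_padicVal_eq_of_heegner`: `W/ℚ`
globally minimal of conductor `N` with `ord_{s=1} L(E,s) = 1`; `K` imaginary quadratic, Heegner for `N`;
`P ∈ E(K)` the Heegner point of a parametrisation datum `Dt` with `p ∤ c(Dt)`; `p` odd, `p ∤ #𝓞_K^×`;
`Wd = Cd • E^{(d_K)}` globally minimal with `ord_p u(Cd) = 0`; `q_d = L(E^{d_K},1)/Ω_{E^{d_K}} ∈ ℚ`, `q_d ≠ 0`.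
RECORD: `2·ord_p [E(K):ℤP] ≤ ord_p q_d + ord_p ∏_ℓ c_ℓ(E) + 2·ord_p #Wd(ℚ)_tors`. CONCLUSION: `#Ш(E)_an = s ∈ ℚ`
with `ord_p s ≤ 0`. PUBLISHED binders `hGZ`, `hKo`, `hGZK`, `hmod`. Per pair; nothing booked.
[cite: JetchevSkinnerWan2017, §7.4.1 (eq:gz for K′) and §7.3.1 (eq:tamK), pp. 29–30]
[cite: GrossZagier1986, V.§2 (pp. 310–312)] [cite: Miller2011LMS, §1 and Def. 1.1] -/
theorem exists_shaAn_padicValRat_le_zero_of_indexRecord_tors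
    (hGZ : gross_zagier N W K) (hKo : kolyvagin N W K)
    (hGZK : rank_eq_analyticRank_of_analyticRank_le_one) (hmod : hasEntireLFunction_rat)
    (hK : IsImaginaryQuadratic K) (hHN : SatisfiesHeegnerHypothesis N K)
    (hP : WeierstrassCurve.Affine.Point.map ι.toRatAlgHom P = heegnerPointComplex Dt H)
    (hp2 : p ≠ 2) (hc : ¬ (p : ℤ) ∣ Dt.c) (hμ : ¬ p ∣ Units.torsionOrder K)
    (hr : W.analyticRank = 1)
    (Wd : WeierstrassCurve ℚ) [Wd.IsElliptic] [Wd.IsGloballyMinimal] (Cd : VariableChange ℚ)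
    (hWd : Cd • W.quadraticTwist (NumberField.discr K : ℚ) = Wd)
    (hu : padicValRat p (Cd.u : ℚ) = 0)
    (qd : ℚ) (hqd : Wd.entireLFunction 1 / (Wd.realPeriodRat : ℂ) = (qd : ℂ)) (hqd0 : qd ≠ 0)
    (hrec : 2 * (padicValNat p (AddSubgroup.zmultiples P).index : ℤ) ≤
      padicValRat p qd + padicValNat p W.tamagawaProduct + 2 * padicValNat p Wd.torsionOrder) :
    ∃ s : ℚ, shaAn W = (s : ℂ) ∧ padicValRat p s ≤ 0 := by
  -- adapted from x11b's `exists_shaAn_padicValRat_eq_of_heegner_of_irr` (torsion term kept)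
  have hD0 : (NumberField.discr K : ℚ) ≠ 0 := by exact_mod_cast NumberField.discr_ne_zero K
  haveI hEt : (W.quadraticTwist (NumberField.discr K : ℚ)).IsElliptic := W.isElliptic_quadraticTwist hD0
  have hLt' : (W.quadraticTwist (NumberField.discr K : ℚ)).entireLFunction = Wd.entireLFunction := by
    rw [← hWd, entireLFunction_smul]
  have hLt : (W.quadraticTwist (NumberField.discr K : ℚ)).entireLFunction 1 ≠ 0 := by
    rw [hLt']
    intro h0
    apply hqd0
    have : ((qd : ℂ)) = 0 := by rw [← hqd, h0, zero_div]
    exact_mod_cast this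
  obtain ⟨-, -, -, s, hs, hid⟩ :=
    X11b.exists_shaAn_padicVal_eq_of_heegner W p N K Dt H ι P hGZ hKo hGZK hmod hK hHN hP hp2 hc hμ hr hLt Wd Cd
      hWd hu qd hqd
  exact ⟨s, hs, by linarith⟩

/-- **Hence the crux's lower half at the pair** (class-free, any odd `p`, any reduction type, `E[p]` reducible
allowed): the record inequality with the torsion term gives `Typed.MissingLowerBoundAt W p` — `ord_p #Ш_an ≤ 0 ≤
ord_p #Ш`. [cite: JetchevSkinnerWan2017, §7.4.1 (eq:gz for K′), pp. 29–30] [cite: Miller2011LMS, §1 and Def. 1.1] -/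
theorem missingLowerBoundAt_of_indexRecord_tors
    (hGZ : gross_zagier N W K) (hKo : kolyvagin N W K)
    (hGZK : rank_eq_analyticRank_of_analyticRank_le_one) (hmod : hasEntireLFunction_rat)
    (hK : IsImaginaryQuadratic K) (hHN : SatisfiesHeegnerHypothesis N K)
    (hP : WeierstrassCurve.Affine.Point.map ι.toRatAlgHom P = heegnerPointComplex Dt H)
    (hp2 : p ≠ 2) (hc : ¬ (p : ℤ) ∣ Dt.c) (hμ : ¬ p ∣ Units.torsionOrder K)
    (hr : W.analyticRank = 1)
    (Wd : WeierstrassCurve ℚ) [Wd.IsElliptic] [Wd.IsGloballyMinimal] (Cd : VariableChange ℚ)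
    (hWd : Cd • W.quadraticTwist (NumberField.discr K : ℚ) = Wd)
    (hu : padicValRat p (Cd.u : ℚ) = 0)
    (qd : ℚ) (hqd : Wd.entireLFunction 1 / (Wd.realPeriodRat : ℂ) = (qd : ℂ)) (hqd0 : qd ≠ 0)
    (hrec : 2 * (padicValNat p (AddSubgroup.zmultiples P).index : ℤ) ≤
      padicValRat p qd + padicValNat p W.tamagawaProduct + 2 * padicValNat p Wd.torsionOrder) :
    MissingLowerBoundAt W p := by
  obtain ⟨s, hs, hsv⟩ := exists_shaAn_padicValRat_le_zero_of_indexRecord_tors W p N K Dt H ι P hGZ hKo hGZK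
    hmod hK hHN hP hp2 hc hμ hr Wd Cd hWd hu qd hqd hqd0 hrec
  exact ⟨s, hs, hsv.trans (by positivity)⟩

/-- **`E[p]` irreducible: the lower half from the record WITHOUT torsion term** — x11b's
`X11b.exists_shaAn_padicValRat_le_zero_of_indexRecord` (the twist has no rational `p`-torsion) read as
`Typed.MissingLowerBoundAt W p`. RECORD: `2·ord_p [E(K):ℤP] ≤ ord_p q_d + ord_p ∏_ℓ c_ℓ(E)`.
[cite: JetchevSkinnerWan2017, §7.4.1 (eq:gz for K′), pp. 29–30] [cite: Mazur1977, Ch. III §5, p. 157]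
[cite: Miller2011LMS, §1 and Def. 1.1] -/
theorem missingLowerBoundAt_of_indexRecord
    (hGZ : gross_zagier N W K) (hKo : kolyvagin N W K)
    (hGZK : rank_eq_analyticRank_of_analyticRank_le_one) (hmod : hasEntireLFunction_rat)
    (hK : IsImaginaryQuadratic K) (hHN : SatisfiesHeegnerHypothesis N K)
    (hP : WeierstrassCurve.Affine.Point.map ι.toRatAlgHom P = heegnerPointComplex Dt H)
    (hp2 : p ≠ 2) (hc : ¬ (p : ℤ) ∣ Dt.c) (hμ : ¬ p ∣ Units.torsionOrder K)
    (hr : W.analyticRank = 1) (hirr : Irr W p)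
    (Wd : WeierstrassCurve ℚ) [Wd.IsElliptic] [Wd.IsGloballyMinimal] (Cd : VariableChange ℚ)
    (hWd : Cd • W.quadraticTwist (NumberField.discr K : ℚ) = Wd)
    (hu : padicValRat p (Cd.u : ℚ) = 0)
    (qd : ℚ) (hqd : Wd.entireLFunction 1 / (Wd.realPeriodRat : ℂ) = (qd : ℂ)) (hqd0 : qd ≠ 0)
    (hrec : 2 * (padicValNat p (AddSubgroup.zmultiples P).index : ℤ) ≤
      padicValRat p qd + padicValNat p W.tamagawaProduct) :
    MissingLowerBoundAt W p := by
  obtain ⟨s, hs, hsv⟩ := X11b.exists_shaAn_padicValRat_le_zero_of_indexRecord W p N K Dt H ι P hGZ hKo hGZK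
    hmod hK hHN hP hp2 hc hμ hr hirr Wd Cd hWd hu qd hqd hqd0 hrec
  exact ⟨s, hs, hsv.trans (by positivity)⟩

end Record

/-! ### §2 The crux AT THE PAIR on every cell row from the record (no Λ, no p-adic GZ, no A′) -/

/-- **Crux `GordTwoRankOne` AT THE PAIR from PUBLISHED facts + ONE exact index record.** For every globally
minimal `E/ℚ` of analytic rank `1` and every pair of cell (G-ord, `e = 2`) (`N10.CellGordTwo W p`: odd additive
(G)-ordinary `p`, `I₀*`) — ANY residual image, CM or not, any parity, anomalous or not — given a Heegner field
`K` (imaginary quadratic, Heegner for the conductor level `N`, `p ∤ #𝓞_K^×`), a parametrisation datum `Dt` with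
`p ∤ c(Dt)`, its Heegner point `P ∈ E(K)`, a minimal twist model `Wd` with `ord_p u = 0`, the twist's central value
`q_d ∈ ℚ^×`, and the record inequality `2·ord_p [E(K):ℤP] ≤ ord_p q_d + ord_p ∏c_ℓ(E) + 2·ord_p #Wd(ℚ)_tors`:
`ord_p #Ш(E)_an ≤ ord_p #Ш(E)`. Binders: Gross–Zagier `hGZ`, Kolyvagin `hKo`, GZK, modularity — PUBLISHED. The
cell hypothesis is idle (displayed so that the planner reads the door on the item); the content is §1.
[cite: JetchevSkinnerWan2017, §7.4.1 (eq:gz for K′) and §7.3.1 (eq:tamK), pp. 29–30]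
[cite: GrossZagier1986, V.§2 (pp. 310–312)] [cite: KolyvaginEulerSystems1990, Thm. A] [cite: Miller2011LMS, Def. 1.1] -/
theorem cellGordTwo_missingLowerBoundAt_of_indexRecord_tors
    {W : WeierstrassCurve ℚ} [W.IsElliptic] [W.IsGloballyMinimal] {p : ℕ} [Fact p.Prime]
    {N : ℕ} [NeZero N] {K : Type} [Field K] [NumberField K]
    (Dt : ModularParametrizationData W N) (H : HeegnerDatum N (NumberField.discr K)) (ι : K →+* ℂ)
    (P : (W.baseChange K).toAffine.Point)
    (hGZ : gross_zagier N W K) (hKo : kolyvagin N W K)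
    (hGZK : rank_eq_analyticRank_of_analyticRank_le_one) (hmod : hasEntireLFunction_rat)
    (_hc2 : N10.CellGordTwo W p) (hr : W.analyticRank = 1)
    (hK : IsImaginaryQuadratic K) (hHN : SatisfiesHeegnerHypothesis N K)
    (hP : WeierstrassCurve.Affine.Point.map ι.toRatAlgHom P = heegnerPointComplex Dt H)
    (hp2 : p ≠ 2) (hc : ¬ (p : ℤ) ∣ Dt.c) (hμ : ¬ p ∣ Units.torsionOrder K)
    (Wd : WeierstrassCurve ℚ) [Wd.IsElliptic] [Wd.IsGloballyMinimal] (Cd : VariableChange ℚ)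
    (hWd : Cd • W.quadraticTwist (NumberField.discr K : ℚ) = Wd)
    (hu : padicValRat p (Cd.u : ℚ) = 0)
    (qd : ℚ) (hqd : Wd.entireLFunction 1 / (Wd.realPeriodRat : ℂ) = (qd : ℂ)) (hqd0 : qd ≠ 0)
    (hrec : 2 * (padicValNat p (AddSubgroup.zmultiples P).index : ℤ) ≤
      padicValRat p qd + padicValNat p W.tamagawaProduct + 2 * padicValNat p Wd.torsionOrder) :
    MissingLowerBoundAt W p :=
  missingLowerBoundAt_of_indexRecord_tors W p N K Dt H ι P hGZ hKo hGZK hmod hK hHN hP hp2 hc hμ hr Wd Cd hWd hu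
    qd hqd hqd0 hrec

end Summit.BirchSwinnertonDyer.BirchSwinnertonDyer.Theorems.AdditiveBranchIMCGordTwoRankOne

end
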